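import Summits.HodgeConjecture.HodgeConjecture.Theorems.MarkmanPartnerTransportPartnerTransportLattice
import Summits.HodgeConjecture.HodgeConjecture.Theorems.MarkmanPartnerTransportPartnerExistenceK3Side
import Literature.AlgebraicGeometry.Hyperkaehler.K3HilbertTypeHodgeIsometryLift
import Literature.AlgebraicGeometry.HodgeTheory.HodgeModelExistence
import Literature.NumberTheory.QuadraticForms.WittExtensionHolds

/-!
# Route MarkmanPartnerTransport · support `PartnerTransport` (stmt-HodgeConjecture-19650) —
# Witt extension: a transcendental Hodge isometry `H²(S) ⊃ T(S) ⥲ T(X) ⊂ H²(X)` of a K3 PARTNER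
# extends to a marked rational Hodge isometry `H²(S^{[2]}) ⥲ H²(X)`

Recipe A, step 2 (ROUTE-P1D §3.2; `p1/route/PartnerTransport-IsometrySpanned-factreduction-g12.md`).
Data: a marked smooth projective fourfold `(X, φ, P, z)` ((m1)–(m6)); a marked projective K3 surface
`(S, η, p, x)`; a smooth projective fourfold `H` marked by `(φ_H, P_H)` with period `(x, 0)` together
with an ALGEBRAIC class `θ` on `H × S` acting as Beauville's marked inclusion
`φ_H([θ]_* a) = (η a, 0)` — the output of `Beauville1983_hilbertSquare_markedIncidence` for `H = S^{[2]}`;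
and `g : H²(S(ℂ); ℂ) → H²(X(ℂ); ℂ)` with the partner clauses (g1) rational, (g2) type-preserving and
(g5) `q(φ g a, φ g b) = (η a · η b)` on cup-transcendental classes.

**`exists_markedHodgeIsometry_of_partner`**: there is a `ℂ`-linear BIJECTION `f : H²(H) → H²(X)`
preserving rational classes and Hodge types with `q(φ f a, φ f b) = q(φ_H a, φ_H b)` — exactly the
four hypotheses of the tree's PROVED consumer
`Markman2024_rationalHodgeIsometry_lift_algebraic_marked.hodgeConjectureFor_iff_K3HilbertSquare`.

Proof.  Inside `(ℚ²³, q) = (Λ_{K3} ⊕ ⟨−2⟩)_ℚ`: the rational transcendental space `T_H = N_ℚ(H)^⊥` is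
regular (`restrict_ratTransc_nondegenerate`) and lies in `Λ_{K3,ℚ} ⊕ 0` (the class `δ` is algebraic,
`…PartnerTransportLattice`); for `t ∈ T_H` the class `η⁻¹(t|_{Λ_{K3}})` is cup-transcendental on `S`
because `[θ]_*` carries `N¹(S)` into `N¹(H)` (algebraic correspondences preserve algebraic classes,
`corrAction_mem_algebraicClasses_of_cupProductFact`).  The rational matrix `G` of `φ ∘ g ∘ η⁻¹`
((g1)) therefore restricts to an injective `q`-ISOMETRY `s = G ∘ pr : T_H → ℚ²³` ((g5),
`k3HilbertForm_inl`), which Witt's theorem (`WittExtension_holds`, Serre IV Thm. 3) extends to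
`σ ∈ O(ℚ²³, q)`.  Put `f = φ⁻¹ ∘ σ_ℂ ∘ φ_H`.  Rationality and the isometry clause are formal; Hodge
types: the period `(x, 0)` lies in `T_H ⊗ ℂ` (`period_mem_span_ratTransc`), where `σ_ℂ = φ g η⁻¹ pr`, so
`σ_ℂ(x, 0) = φ g(η⁻¹ x) = t · z` with `t ≠ 0` ((g2), (m4)); hence `(2,0) ↦ (2,0)`, `(1,1) ↦ (1,1)` by
(m5) and the isometry/reality of `σ_ℂ`, `(0,2) ↦ (0,2)` by conjugation (`marking_conjClass`).

No definition, no sorry, no named fact (the Witt theorem and Lefschetz `(1,1)` are tree theorems; the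
multiplicativity fact `Voisin2003_cupProduct_algebraicClasses` is a hypothesis, as in the consumer).
Prover seat hodge-nonav-19652-p1 (gen 6), `--supports stmt-HodgeConjecture-19650`.

References: A. Beauville, J. Differential Geom. 18 (1983) §6 Prop. 6, §9; J.-P. Serre, *A Course in
Arithmetic* IV §1.5 Thm. 3; D. Huybrechts, *Lectures on K3 Surfaces* Ch. 3 §2–3; E. Markman, Compos.
Math. 160 (2024) Thm. 1.1.
-/

noncomputable section

set_option linter.dupNamespace false

open scoped Matrix
open Module CategoryTheory MonoidalCategory
open Literature.AlgebraicTopology.SingularHomology Literature.Geometry.Kaehler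
open Literature.AlgebraicGeometry Literature.AlgebraicGeometry.Motives Literature.AlgebraicGeometry.HodgeTheory
open Literature.AlgebraicGeometry.Hyperkaehler Literature.AlgebraicGeometry.Surfaces
open Literature.NumberTheory.QuadraticForms
open Summit.HodgeConjecture.HodgeConjecture.Theorems.NikulinTwinTransport
open Summit.HodgeConjecture.HodgeConjecture.Theorems.MarkmanPartnerTransport.BBFPositivity

namespace Summit.HodgeConjecture.HodgeConjecture.Theorems.MarkmanPartnerTransport.PartnerLattice

/-- `MarkedK3Sq[X, φ, P, z]`: VERBATIM the `let MarkedK3Sq := …` binder of the route declarations of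
MarkmanPartnerTransport (clauses (m1)–(m6)). Local notation only. -/
local notation3 (prettyPrint := false) "MarkedK3Sq[" X ", " φ ", " P ", " z "]" =>
  (((IsIntegralClass P ∧ ∀ Q : complexBetti X (2 * 4), IsIntegralClass Q → ∃ n : ℤ, Q = n • P) ∧
    (∀ c : complexBetti X 2, IsIntegralClass c ↔ ∃ v : K3HilbertIndex → ℤ, φ c = fun i => (v i : ℂ)) ∧
    (∀ a : complexBetti X 2, cupPowTwo a 4 = ((3 : ℂ) * (k3HilbertForm 2 (φ a) (φ a)) ^ 2) • P) ∧
    (IsOfHodgeType 4 X 2 2 0 (LinearEquiv.symm φ z) ∧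
      ∀ τ : complexBetti X 2, IsOfHodgeType 4 X 2 2 0 τ → ∃ t : ℂ, τ = t • LinearEquiv.symm φ z) ∧
    (∀ c : complexBetti X 2, IsOfHodgeType 4 X 2 1 1 c ↔
      (k3HilbertForm 2 (φ c) z = 0 ∧ k3HilbertForm 2 (φ c) (star z) = 0)) ∧
    (k3HilbertForm 2 z z = 0 ∧ 0 < (k3HilbertForm 2 (star z) z).re)))

/-- `qQ` = the rational Beauville–Bogomolov form of `K3^{[2]}`-type on `ℚ²³`. Local notation only. -/
local notation3 (prettyPrint := false) "qQ" => Matrix.toBilin' (Matrix.map (k3HilbertGram 2) (Int.cast : ℤ → ℚ))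

/-- `cz[τ]` = the complexification of a `ℚ`-linear `τ : ℚ²³ → ℚ²³`. Local notation only. -/
local notation3 (prettyPrint := false) "cz[" τ "]" =>
  Matrix.toLin' (Matrix.map (LinearMap.toMatrix' (R := ℚ) τ) (Rat.cast : ℚ → ℂ))

/-- **Witt extension of a partner isometry to a marked rational Hodge isometry `H²(S^{[2]}) ⥲ H²(X)`**
(module docstring): for marked `(X, φ, P, z)`, a marked projective K3 `(S, η, p, x)`, a fourfold `H`
marked by `(φ_H, P_H)` with period `(x, 0)` and an algebraic `θ` on `H × S` with `φ_H([θ]_* a) = (η a, 0)`,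
and `g : H²(S) → H²(X)` rational, type-preserving and isometric on cup-transcendental classes, there is
a bijective `f : H²(H) → H²(X)` preserving rational classes and Hodge types with
`q(φ f a, φ f b) = q(φ_H a, φ_H b)`. [cite: Serre1973, Ch. IV §1.5 Thm 3, p. 30]
[cite: Beauville1983, §6 Prop. 6 and §9 Lemme 1] [cite: Huybrechts2016K3, Ch. 3 Lemma 3.1] -/
theorem exists_markedHodgeIsometry_of_partner
    (hcup : Voisin2003_cupProduct_algebraicClasses) {μ : OrientationFamily} (hμ : μ.HasPoincareDuality)
    {X : SchemeOver ℂ} (hX : IsSmoothProjective 4 X)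
    {φ : complexBetti X 2 ≃ₗ[ℂ] (K3HilbertIndex → ℂ)} {P : complexBetti X (2 * 4)} {z : K3HilbertIndex → ℂ}
    (hM : MarkedK3Sq[X, φ, P, z])
    {S : SchemeOver ℂ} (hS : IsK3Surface S) {η : complexBetti S (2 * 1) ≃ₗ[ℂ] (K3Index → ℂ)}
    {p : complexBetti S (2 * 2)} {x : K3Index → ℂ}
    (hηint : ∀ c : complexBetti S (2 * 1), IsIntegralClass c ↔ ∃ v : K3Index → ℤ, η c = fun i => (v i : ℂ))
    (hcupS : ∀ a b : complexBetti S (2 * 1),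
      cupProduct (rfl : 2 * 1 + 2 * 1 = 2 * 2) a b = k3Form (η a) (η b) • p)
    (h20 : IsOfHodgeType 2 S (2 * 1) 2 0 (η.symm x)) (hxpos : 0 < (k3Form (star x) x).re)
    {H : SchemeOver ℂ} (hH : IsSmoothProjective 4 H)
    {φH : complexBetti H 2 ≃ₗ[ℂ] (K3HilbertIndex → ℂ)} {PH : complexBetti H (2 * 4)}
    (hMH : MarkedK3Sq[H, φH, PH, Sum.elim x 0])
    {θ : complexBetti (H ⊗ S) (2 * 2)} (hθ : θ ∈ algebraicClasses (H ⊗ S) 2)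
    (hi : ∀ a : complexBetti S (2 * 1),
      φH (corrAction μ hH (IsK3Surface.isSmoothProjective hS) (rfl : 2 * 1 + 2 * 2 = 2 + 2 * 2) θ a) =
        Sum.elim (η a) 0)
    {g : complexBetti S (2 * 1) →ₗ[ℂ] complexBetti X 2}
    (hg1 : ∀ a, IsRationalClass a → IsRationalClass (g a))
    (hg2 : ∀ (i j : ℕ) a, IsOfHodgeType 2 S (2 * 1) i j a → IsOfHodgeType 4 X 2 i j (g a))
    (hg5 : ∀ a b, (∀ d ∈ algebraicClasses S 1, cupProduct (rfl : 2 * 1 + 2 * 1 = 2 * 2) a d = 0) →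
      (∀ d ∈ algebraicClasses S 1, cupProduct (rfl : 2 * 1 + 2 * 1 = 2 * 2) b d = 0) →
      k3HilbertForm 2 (φ (g a)) (φ (g b)) = k3Form (η a) (η b)) :
    ∃ f : complexBetti H 2 →ₗ[ℂ] complexBetti X 2, Function.Bijective f ∧
      (∀ c, IsRationalClass c → IsRationalClass (f c)) ∧
      (∀ (i j : ℕ) c, IsOfHodgeType 4 H 2 i j c → IsOfHodgeType 4 X 2 i j (f c)) ∧
      ∀ a b, k3HilbertForm 2 (φ (f a)) (φ (f b)) = k3HilbertForm 2 (φH a) (φH b) := by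
  classical
  obtain ⟨-, hint, -, ⟨-, hz20span⟩, h11, -⟩ := id hM
  obtain ⟨-, hintH, -, ⟨-, hzH20span⟩, h11H, -⟩ := id hMH
  have hS2 : IsSmoothProjective 2 S := IsK3Surface.isSmoothProjective hS
  -- the rational Néron–Severi and transcendental spaces of `H`
  obtain ⟨NH, hNH⟩ := exists_ratNeronSeveri (X := H) φH
  have hTnd := restrict_ratTransc_nondegenerate hH hMH hNH
  have hzH : (Sum.elim x 0 : K3HilbertIndex → ℂ) ∈ Submodule.span ℂ
      ((fun a : K3HilbertIndex → ℚ => fun i => (a i : ℂ)) ''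
        ((qQ).orthogonal NH : Set (K3HilbertIndex → ℚ))) := period_mem_span_ratTransc hH hMH hNH
  -- `[θ]_*` carries `N¹(S)` into `N¹(H)`
  have hiN : ∀ d ∈ algebraicClasses S 1,
      corrAction μ hH hS2 (rfl : 2 * 1 + 2 * 2 = 2 + 2 * 2) θ d ∈ algebraicClasses H 1 := fun d hd =>
    corrAction_mem_algebraicClasses_of_cupProductFact hcup hμ hH hS2 (q := 1) rfl (by norm_num) hθ hd
  -- vectors of `T_H`: no `δ`-component, `K3`-part cup-transcendental
  have hTsum : ∀ t ∈ (qQ).orthogonal NH,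
      (fun i => (t i : ℂ)) = Sum.elim (fun k => (t (Sum.inl k) : ℂ)) 0 := fun t ht =>
    ratCast_eq_sumElim_of_mem_ratTransc hH hMH hNH ht
  have hTtransc : ∀ t ∈ (qQ).orthogonal NH, ∀ d ∈ algebraicClasses S 1,
      cupProduct (rfl : 2 * 1 + 2 * 1 = 2 * 2) (η.symm (fun k => (t (Sum.inl k) : ℂ))) d = 0 := by
    intro t ht d hd
    have h0 : k3HilbertForm 2 (fun i => (t i : ℂ))
        (φH (corrAction μ hH hS2 (rfl : 2 * 1 + 2 * 2 = 2 + 2 * 2) θ d)) = 0 :=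
      (ratCast_bbfTransc_iff_mem_orthogonal hH hintH hNH t).2 ht _ (hiN d hd)
    rw [hi d, hTsum t ht, k3HilbertForm_inl] at h0
    rw [hcupS, LinearEquiv.apply_symm_apply, h0, zero_smul]
  -- the rational matrix of `φ ∘ g ∘ η⁻¹`
  set L : (K3Index → ℂ) →ₗ[ℂ] (K3HilbertIndex → ℂ) :=
    (φ : complexBetti X 2 →ₗ[ℂ] (K3HilbertIndex → ℂ)) ∘ₗ g ∘ₗ
      (η.symm : (K3Index → ℂ) →ₗ[ℂ] complexBetti S (2 * 1)) with hLdef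
  have hLapp : ∀ y, L y = φ (g (η.symm y)) := fun y => rfl
  have hLrat : ∀ v : K3Index → ℚ, ∃ w : K3HilbertIndex → ℚ,
      L (fun i => (v i : ℂ)) = fun i => (w i : ℂ) := fun v => by
    rw [hLapp]
    exact (isRationalClass_iff_of_markedSq hX hint _).1
      (hg1 _ ((isRationalClass_iff_of_marking hS η hηint _).2 ⟨v, LinearEquiv.apply_symm_apply _ _⟩))
  obtain ⟨Gq, hGq⟩ := exists_ratLinear_of_forall_ratCast L hLrat
  -- `G' = Gq ∘ pr_{Λ_{K3}}` on `ℚ²³`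
  set G' : (K3HilbertIndex → ℚ) →ₗ[ℚ] (K3HilbertIndex → ℚ) :=
    Gq ∘ₗ LinearMap.funLeft ℚ ℚ (Sum.inl : K3Index → K3HilbertIndex) with hG'def
  have hG'rat : ∀ t ∈ (qQ).orthogonal NH,
      (fun i => ((G' t) i : ℂ)) = φ (g (η.symm (fun k => (t (Sum.inl k) : ℂ)))) := fun t _ => by
    rw [hG'def, LinearMap.comp_apply, hGq, hLapp]
    rfl
  have hG'iso : ∀ a ∈ (qQ).orthogonal NH, ∀ b ∈ (qQ).orthogonal NH, qQ (G' a) (G' b) = qQ a b := by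
    intro a ha b hb
    have h : k3HilbertForm 2 (fun i => ((G' a) i : ℂ)) (fun i => ((G' b) i : ℂ)) =
        k3HilbertForm 2 (fun i => (a i : ℂ)) (fun i => (b i : ℂ)) := by
      rw [hG'rat a ha, hG'rat b hb, hg5 _ _ (hTtransc a ha) (hTtransc b hb),
        LinearEquiv.apply_symm_apply, LinearEquiv.apply_symm_apply, hTsum a ha, hTsum b hb,
        k3HilbertForm_inl]
    rw [k3HilbertForm_ratCast, k3HilbertForm_ratCast] at h
    exact_mod_cast h
  -- Witt: extend `G'|_{T_H}` to `σ ∈ O(ℚ²³, q)`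
  set B : LinearMap.BilinForm ℚ (K3HilbertIndex → ℚ) := qQ with hBdef
  set TH : Submodule ℚ (K3HilbertIndex → ℚ) := (qQ).orthogonal NH with hTHdef
  let s : (B.restrict TH).Isometry B :=
    { toLinearMap := G' ∘ₗ TH.subtype
      map_app' := fun a b => by
        rw [LinearMap.BilinForm.restrict_apply]
        exact hG'iso a a.2 b b.2 }
  have hsapp : ∀ t : TH, s t = G' t := fun t => rfl
  have hsinj : Function.Injective s := by
    intro a b hab
    have h0 : G' ((a - b : TH) : K3HilbertIndex → ℚ) = 0 := by
      rw [← hsapp, map_sub, hab, sub_self]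
    have hzero : (a - b : TH) = 0 := by
      apply hTnd.1
      intro n
      rw [LinearMap.BilinForm.restrict_apply]
      show qQ ((a - b : TH) : K3HilbertIndex → ℚ) n = 0
      rw [← hG'iso _ (a - b).2 _ n.2, h0, map_zero, LinearMap.zero_apply]
    exact sub_eq_zero.1 hzero
  obtain ⟨σL, hσL⟩ := WittExtension_holds ℚ two_ne_zero (K3HilbertIndex → ℚ) (K3HilbertIndex → ℚ) B B
    (isSymm_toBilin'_map (R := ℚ) (k3HilbertGram 2) (k3HilbertGram_transpose 2))
    (isSymm_toBilin'_map (R := ℚ) (k3HilbertGram 2) (k3HilbertGram_transpose 2))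
    qQ_nondegenerate qQ_nondegenerate (LinearMap.BilinForm.Equivalent.refl B) TH s hsinj
  set τe : (K3HilbertIndex → ℚ) ≃ₗ[ℚ] (K3HilbertIndex → ℚ) :=
    (σL : (K3HilbertIndex → ℚ) ≃ₗ[ℚ] (K3HilbertIndex → ℚ)) with hτe
  set τ : (K3HilbertIndex → ℚ) →ₗ[ℚ] (K3HilbertIndex → ℚ) :=
    (τe : (K3HilbertIndex → ℚ) →ₗ[ℚ] (K3HilbertIndex → ℚ)) with hτ
  have hτapp : ∀ v, τ v = σL v := fun v => rfl
  have hτiso : ∀ v w, qQ (τ v) (τ w) = qQ v w := fun v w => by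
    rw [hτapp, hτapp]
    exact σL.map_app w v
  have hτT : ∀ t (ht : t ∈ TH), τ t = G' t := fun t ht => (hσL ⟨t, ht⟩).trans (hsapp ⟨t, ht⟩)
  -- the complexification `Ψ = σ_ℂ`
  have hΨiso : ∀ a b, k3HilbertForm 2 (cz[τ] a) (cz[τ] b) = k3HilbertForm 2 a b :=
    k3HilbertForm_cplx_cplx τ hτiso
  have hΨbij : Function.Bijective cz[τ] := cplx_bijective τe
  have hΨrat : ∀ v : K3HilbertIndex → ℚ, cz[τ] (fun i => (v i : ℂ)) = fun i => ((τ v) i : ℂ) :=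
    cplx_ratCast τ
  have hΨstar : ∀ w, cz[τ] (star w) = star (cz[τ] w) := cplx_star τ
  -- on `T_H ⊗ ℂ`, `Ψ = φ ∘ g ∘ η⁻¹ ∘ pr`
  set L' : (K3HilbertIndex → ℂ) →ₗ[ℂ] (K3HilbertIndex → ℂ) :=
    L ∘ₗ LinearMap.funLeft ℂ ℂ (Sum.inl : K3Index → K3HilbertIndex) with hL'def
  have hL'app : ∀ y : K3HilbertIndex → ℂ, L' y = φ (g (η.symm (fun k => y (Sum.inl k)))) := fun y => rfl
  have hΨT : ∀ y ∈ Submodule.span ℂ ((fun a : K3HilbertIndex → ℚ => fun i => (a i : ℂ)) ''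
      (TH : Set (K3HilbertIndex → ℚ))), cz[τ] y = φ (g (η.symm (fun k => y (Sum.inl k)))) := by
    intro y hy
    rw [← hL'app]
    refine eq_on_span_ratCast cz[τ] L' _ (fun t ht => ?_) hy
    rw [hΨrat, hτT t ht, hG'rat t ht, hL'app]
  -- the period: `Ψ (x, 0) = φ g η⁻¹ x = t · z`, `t ≠ 0`
  have hΨzH : cz[τ] (Sum.elim x 0) = φ (g (η.symm x)) := by
    rw [hΨT _ hzH]
    rfl
  have hg20 : IsOfHodgeType 4 X 2 2 0 (g (η.symm x)) := hg2 2 0 _ h20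
  obtain ⟨t, ht⟩ := hz20span _ hg20
  have hΨz : cz[τ] (Sum.elim x 0) = t • z := by
    rw [hΨzH, ht, map_smul, LinearEquiv.apply_symm_apply]
  have hx0 : (Sum.elim x 0 : K3HilbertIndex → ℂ) ≠ 0 := by
    intro h
    apply period_ne_zero hxpos
    funext k
    simpa using congrFun h (Sum.inl k)
  have ht0 : t ≠ 0 := by
    rintro rfl
    rw [zero_smul] at hΨz
    exact hx0 (hΨbij.1 (by rw [hΨz, map_zero]))
  have hz_eq : z = t⁻¹ • cz[τ] (Sum.elim x 0) := by
    rw [hΨz, smul_smul, inv_mul_cancel₀ ht0, one_smul]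
  -- `f = φ⁻¹ ∘ Ψ ∘ φ_H`
  set f : complexBetti H 2 →ₗ[ℂ] complexBetti X 2 :=
    (φ.symm : (K3HilbertIndex → ℂ) →ₗ[ℂ] complexBetti X 2) ∘ₗ cz[τ] ∘ₗ
      (φH : complexBetti H 2 →ₗ[ℂ] (K3HilbertIndex → ℂ)) with hfdef
  have hφf : ∀ c, φ (f c) = cz[τ] (φH c) := fun c => by
    rw [hfdef, LinearMap.comp_apply, LinearMap.comp_apply, LinearEquiv.coe_coe, LinearEquiv.coe_coe,
      LinearEquiv.apply_symm_apply]
  have hfx : f (φH.symm (Sum.elim x 0)) = g (η.symm x) := by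
    apply φ.injective
    rw [hφf, LinearEquiv.apply_symm_apply, hΨzH]
  have hfconj : ∀ c, f (conjClass (ComplexPoints H) 2 c) = conjClass (ComplexPoints X) 2 (f c) := by
    intro c
    apply φ.injective
    rw [hφf, marking_conjClass hintH, hΨstar, marking_conjClass hint, hφf]
  refine ⟨f, ?_, ?_, ?_, ?_⟩
  · -- bijective
    exact (φ.symm.bijective.comp hΨbij).comp φH.bijective
  · -- rational classes
    intro c hc
    obtain ⟨w, hw⟩ := (isRationalClass_iff_of_markedSq hH hintH c).1 hc
    exact (isRationalClass_iff_of_markedSq hX hint (f c)).2 ⟨τ w, by rw [hφf, hw, hΨrat]⟩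
  · -- Hodge types
    intro i j c hc
    by_cases hij : i + j = 2
    · have hi2 : i ≤ 2 := by omega
      interval_cases i
      · -- `(0,2)`: by conjugation
        have hj : j = 2 := by omega
        subst hj
        obtain ⟨s', hs'⟩ := hzH20span _ (hc.conjClass hH)
        rw [← conjClass_conjClass (f c), ← hfconj]
        refine IsOfHodgeType.conjClass hX ?_
        rw [hs', map_smul, hfx]
        exact hg20.smul s'
      · -- `(1,1)`: orthogonality to `z = t⁻¹ Ψ(x,0)` and `z̄`
        have hj : j = 1 := by omega
        subst hj
        obtain ⟨hc1, hc2⟩ := (h11H c).1 hc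
        refine (h11 (f c)).2 ⟨?_, ?_⟩
        · rw [hφf, hz_eq, k3HilbertForm_smul_right, hΨiso, hc1, mul_zero]
        · rw [hφf, hz_eq, star_smul, ← hΨstar, k3HilbertForm_smul_right, hΨiso, hc2, mul_zero]
      · -- `(2,0)`
        have hj : j = 0 := by omega
        subst hj
        obtain ⟨s', rfl⟩ := hzH20span c hc
        rw [map_smul, hfx]
        exact hg20.smul s'
    · -- no classes of type `(i, j)`, `i + j ≠ 2`, in `H²`
      have hc0 : c = 0 := by
        obtain ⟨A, hA⟩ := hc
        rw [(A.hodgePQ_eq_bot_iff 2 i j).2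
            (Literature.NumberTheory.Transcendental.hodgePQ_eq_bot_of_ne (M := A.carrier) hij),
          Submodule.mem_bot] at hA
        exact A.pullback_injective 2 (by rw [hA, map_zero])
      rw [hc0, map_zero]
      exact isOfHodgeType_zero_of_isSmoothProjective nonempty_hodgeModel_holds hX 2 i j
  · -- isometry in the markings
    intro a b
    rw [hφf, hφf, hΨiso]

end Summit.HodgeConjecture.HodgeConjecture.Theorems.MarkmanPartnerTransport.PartnerLattice

end
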